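/-
Copyright (c) 2026 the pub-hodgecm-mathlib formalisation cell (harness21).  Prover seat hodgecm-mathlib-R90-C10-p04 (g2), SLAB R90-TF, section S1 «Ch. 10∕12 local»,
cell «U4-RAM :182 B_pos (ramified tame)» (line (D-1) of R90-C10-p05 (g2), dealer R90-C10-plan (g2) R-S1-22): brick (6a), PART 3 «THE GAUSS SQUARE» for the U4Keys socket
:182 ∕ (S-RT) (ramified `χ₁` of positive depth, Branch B, tame ramified place), crux H413 = `stmt-HodgeConjecture-24833`.  KERNEL module: THEOREMS ONLY (no definition, no named
fact, no `sorry`, no instance, no notation).  2026-09-05.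
-/
import Summits.HodgeConjecture.HodgeConjecture.Theorems.R90S1BposRamGaussSphereInner     -- ★∕📤 (6a) PART 2 (this seat): transport + inner integrals; brings PART 1, the tool file, ★ (5a)
import HarnessLib

/-!
# R90 · S1 ∕ U4Keys leaf (U4f-χ₁-ram-one-pos), BRANCH B, TAME RAMIFIED — brick (6a), PART 3: THE GAUSS SQUARE ON THE LEVEL-ONE SPHERE
# `Φ(a) := ∫_{s ∈ R⁻, |s_w| = q_w⁻¹} χ₁((a − s)^)⁻¹ dμ⁻(s)`, `a` σ-fixed: `Φ(a) = 0` below the critical level, and **`Φ(a)²·X = q⁻¹·μ⁻{|y_w| ≤ 1}²`** at `|a_w| = |ϖ|^(m+1)`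
# (`m + 1 = cond χ₁`, `X = χ₁(σΠ·Π)`) — the quadratic Gauss sum `𝔤² = ε(−1)q` of PAPER P-ram-1 §1 (P3), never evaluated   [Keys1984 §4–§5, §7 Thm (2); IrelandRosen1990 Ch. 8 §2; WeilBNT1967 Ch. II §5]

Cell `pub/hodgecm-mathlib` (D-0151), SLAB R90-TF, section S1 «Ch. 10∕12 local», crux H413 = `stmt-HodgeConjecture-24833` (lane `--supports … --as helper`), route of record
`HCCMUnconditional` (no route verbs); prover seat `hodgecm-mathlib-R90-C10-p04` (g2), card (6a) `R90S1BposRamGaussSphere` (dealer R-S1-22 01:17:56Z; HEADS 01:32:31Z; p01 (g3)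
cross-read «=» 01:35:01Z, currency notes (i) m-letters and (ii) `hFε` adopted).  THEOREMS ONLY; ★-only imports (no `Lines` import).  NOT THE PAYER of :182 ∕ (S-RT).

FRAME = PART 1 ∕ PART 2.  LETTERS: `he`, `h2w`, `χ₁ h₁`, `hB` (frame-v1 bytes), `hfixP` (★ p863838), `{ϖ} (hϖ) {m} (hm : 1 ≤ m)`, `hcond` at `|ϖ|^(m+1)`, `u₁ hu₁ hχu₁` at `|ϖ|^m`, the (R-b)
selector `hFε : ∃ a₀ : Rˣ, Units.map σ a₀ = a₀ ∧ (∀ w′, |a₀ w′| = 1) ∧ χ₁ a₀ ≠ 1` ((7) ★ p864034's spelling), `(piU) (hpiU : ∀ w′, |piU w′| = exp(−1))` and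
`X := ((χ₁ (Units.map σ piU * piU) : ℂˣ) : ℂ)` (ONE CURRENCY RULE), `q := Ideal.absNorm v.asIdeal` (`= absNorm w.1.asIdeal`, ★ `absNorm_placesOver_eq_of_ramified`).
THE RESULTS (`Ē r = χ₁(r̂)⁻¹`, `S₁ = {s ∈ R⁻ : |s_w| = exp(−1)}`, `Φ(a) = ∫_{S₁} Ē(a − s) dμ⁻`):
* §1 **`setIntegral_sphere_diteInv_sub_eq_zero_of_le`** — BELOW THE CRITICAL LEVEL (`|a_w| ≤ |ϖ|^(m+2)`, `a` fixed): `Φ(a) = 0` in (R-b) (transport to the fixed units, `Ē(1 + uc⁻¹) = 1`,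
  orthogonality `∫_C χ₁(ĉ)⁻¹ dν = 0` of the tool file).
* §2 **`sq_setIntegral_sphere_diteInv_sub_mul_eq`** — AT THE CRITICAL LEVEL (`|a_w| = |ϖ|^(m+1)`, `a` fixed): **`Φ(a)^2 * X = q⁻¹ * (μ⁻.real {y : |y_w| ≤ 1})^2`**.  Proof = HEADS
  01:32:31Z: `Φ = χ₁(−δ)⁻¹·T⁻` (PART 2 §1), `T⁻ = 𝔗 := ∫_C χ₁(ĉ)Ē(1 + uc) dν` (INVERSION INVARIANCE, tool §2), `𝔗² = ∫_C∫_C χ₁(ê)Ē(1 + uc(1+e))` (substitution `c′ = ce`, `χ₁(ĉ·σĉ) = 1`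
  by `hB`, exact additivity PART 1), Fubini, inner integrals PART 2 §2 (`−ν(𝔪⁺)` for `|1+e| = 1`, `ν(C)` for `|1+e| < 1`), `∫_C χ₁(ê) = 0` (tool §3, `hFε`), `∫_{|1+e|<1} χ₁(ê) = χ₁(−1)ν(𝔪⁺)`
  (`hfixP`, translation), masses `ν(𝒪⁺) = μ⁻{|y| ≤ 1}`, `ν(𝔪⁺) = q⁻¹μ⁻{|y| ≤ 1}` (parity + ★ `measure_setOf_skew_valued_le_exp_neg_two_of_ramified`), and `χ₁((−δ)²) = χ₁(−1)·X` (`δ² = −δσδ`,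
  `δσδ = (σΠ·Π)·N(δΠ⁻¹)`, `hB`).  SIGN-FREE: `χ₁(−1)` cancels.
HONEST LABEL.  HC_CM is proved only modulo the 7 printed citations (2 remaining named inputs: hLiu418 = `stmt-HodgeConjecture-24832`, h413 = `stmt-HodgeConjecture-24833`) until rung 0
closes; count-neutral — this file pays NO socket (:182, (S-RT), A2′ stay OPEN); no printed citation is discharged; REL ≠ ★ ≠ BUILT.

## References
* [Keys1984] D. Keys, *Principal series representations of special unitary groups over local fields*, Compositio Math. 51 (1984), §4–§5, §7 Theorem (2) (d) p. 126.
* [IrelandRosen1990] K. Ireland, M. Rosen, *A Classical Introduction to Modern Number Theory*, GTM 84 (1990), Ch. 8 §2 Prop. 8.2.2 (`g² = ε(−1)q`).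
* [WeilBNT1967] A. Weil, *Basic Number Theory* (1967), Ch. II §5 (Haar measure on `k^×`, orthogonality, Fubini).
* [Rogawski1990] J. D. Rogawski, *Automorphic Representations of Unitary Groups in Three Variables*, Ann. of Math. Stud. 123 (1990), §12.2 (2) p. 173.
-/

set_option autoImplicit false
-- the mandated namespace has the single-problem summit's repeated segment (`HodgeConjecture.HodgeConjecture`)
set_option linter.dupNamespace false

noncomputable section

open NumberField IsDedekindDomain MeasureTheory Measure Topology Set
open scoped NNReal ENNReal
open Literature.NumberTheory Literature.NumberTheory.Automorphic Literature.NumberTheory.Automorphic.UnitaryGroup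

namespace Summit.HodgeConjecture.HodgeConjecture.R90.S1.BposRamGaussSphere

open Summit.HodgeConjecture.HodgeConjecture.Cruxes.H413
open Summit.HodgeConjecture.HodgeConjecture.Cruxes.H413.K2E3BranchBSkewUnitSign
open Summit.HodgeConjecture.HodgeConjecture.Cruxes.H413.K2E3BranchBSkewLineIntegrals
open Summit.HodgeConjecture.HodgeConjecture.Cruxes.H413.K2E3BranchBSkewLineCharacterIntegral
open Summit.HodgeConjecture.HodgeConjecture.R90.S1.BposSkewBallCharacterTools
open Summit.HodgeConjecture.HodgeConjecture.R90.S1.BposRamFixedUnitsHaar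
open Summit.HodgeConjecture.HodgeConjecture.R90.S1.BposRamSkewSphereByFixedUnits
open Summit.HodgeConjecture.HodgeConjecture.R90.S1.BposRamGaussSphereInner

variable (L : Type) [Field L] [NumberField L] [IsCMField L] (v : HeightOneSpectrum (𝓞 ↥(maximalRealSubfield L)))
  (w : PlacesOver L v) (hw : IsCMField.complexConj L • w.1 = w.1)

/-! ## §0 Bookkeeping: the skew base point `δ` and the parameter `u = −aδ⁻¹` -/

/-- `|(δ⁻¹)_w| = exp(1)` and, for `|a_w| = |ϖ|^(m+1)`, the skew parameter `u := −(aδ⁻¹)` has `σu = −u` and `|u_w| = |ϖ|^m` (`a` fixed, `δ` skew of order one). [cite: Keys1984, §4] -/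
theorem skew_param_facts (δ : (LocalRing L v)ˣ) (hδ : conjLocal L (IsCMField.complexConj L) v (δ : LocalRing L v) = -(δ : LocalRing L v))
    (hδv : Valued.v ((δ : LocalRing L v) w) = WithZero.exp (-1 : ℤ)) {ϖ : w.1.adicCompletion L} (hϖ : Valued.v ϖ = WithZero.exp (-1 : ℤ)) {m : ℕ}
    {a : LocalRing L v} (ha : conjLocal L (IsCMField.complexConj L) v a = a) (hav : Valued.v (a w) = Valued.v ϖ ^ (m + 1)) :
    conjLocal L (IsCMField.complexConj L) v (-(a * ((δ⁻¹ : (LocalRing L v)ˣ) : LocalRing L v))) = -(-(a * ((δ⁻¹ : (LocalRing L v)ˣ) : LocalRing L v))) ∧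
      Valued.v ((-(a * ((δ⁻¹ : (LocalRing L v)ˣ) : LocalRing L v))) w) = Valued.v ϖ ^ m := by
  refine ⟨by rw [map_neg, map_mul, ha, HeisRing.map_units_inv_of_antifixed (conjLocal L (IsCMField.complexConj L) v) δ hδ, mul_neg], ?_⟩
  have hinv : Valued.v (((δ⁻¹ : (LocalRing L v)ˣ) : LocalRing L v) w) = (Valued.v ϖ)⁻¹ := by
    have h := congrArg Valued.v (units_apply_mul_inv_apply L v δ w)
    rw [map_mul, map_one, hδv, ← hϖ] at h
    exact eq_inv_of_mul_eq_one_right h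
  have hϖ0 : Valued.v ϖ ≠ 0 := by rw [hϖ]; exact WithZero.exp_ne_zero
  rw [Pi.neg_apply, Valuation.map_neg, Pi.mul_apply, map_mul, hav, hinv, pow_succ, mul_assoc, mul_inv_cancel₀ hϖ0, mul_one]


section Sphere

variable [MeasurableSpace (LocalRing L v)] [BorelSpace (LocalRing L v)]
  (μY : Measure ↥(HeisRing.skewPart (conjLocal L (IsCMField.complexConj L) v))) [μY.IsAddHaarMeasure] [μY.Regular]

/-! ## §1 BELOW THE CRITICAL LEVEL the sphere fibre vanishes in (R-b) -/

open scoped Classical in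
include hw in
/-- **`Φ(a) = ∫_{S₁} Ē(a − s) dμ⁻ = 0` for EVERY `a` with `|a_w| ≤ |ϖ|^(m+2)`** (no `σ`-fixedness needed) in the sub-branch (R-b) (`hFε`), `χ₁` trivial at level `|ϖ|^(m+1)` (`hcond`): after the
transport to the fixed units (PART 2 §1) the principal factor `Ē(1 + uc⁻¹)` is `1` (`|uc⁻¹| = |a|·exp(1) ≤ |ϖ|^(m+1)`) and `∫_C χ₁(ĉ)⁻¹ dν = 0` (tool §3).  (The shells deeper than the
critical one of PAPER P-ram-1 §2 (O), `m ≥ n + 1`.) [cite: Keys1984, §4–§5, §7 Theorem (2) (d) p. 126] [cite: WeilBNT1967, Ch. II §5] -/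
theorem setIntegral_sphere_diteInv_sub_eq_zero_of_le (he : v.asIdeal.ramificationIdx' w.1.asIdeal ≠ 1) (h2w : Valued.v (2 : w.1.adicCompletion L) = 1)
    (χ₁ : (LocalRing L v)ˣ →* ℂˣ) {ϖ : w.1.adicCompletion L} (hϖ : Valued.v ϖ = WithZero.exp (-1 : ℤ)) {m : ℕ}
    (hcond : ∀ u : (LocalRing L v)ˣ, (∀ w' : PlacesOver L v, Valued.v (((u : LocalRing L v) w') - 1) ≤ Valued.v ϖ ^ (m + 1)) → χ₁ u = 1)
    (hFε : ∃ a₀ : (LocalRing L v)ˣ, Units.map (conjLocal L (IsCMField.complexConj L) v : LocalRing L v →* LocalRing L v) a₀ = a₀ ∧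
      (∀ w' : PlacesOver L v, Valued.v ((a₀ : LocalRing L v) w') = 1) ∧ χ₁ a₀ ≠ 1)
    {a : LocalRing L v} (hav : Valued.v (a w) ≤ Valued.v ϖ ^ (m + 2)) :
    ∫ s in {s : ↥(HeisRing.skewPart (conjLocal L (IsCMField.complexConj L) v)) | Valued.v ((s : LocalRing L v) w) = WithZero.exp (-1 : ℤ)},
        (fun r : LocalRing L v => if h : IsUnit r then (((χ₁ h.unit)⁻¹ : ℂˣ) : ℂ) else 0) (a - (s : LocalRing L v)) ∂μY = 0 := by
  obtain ⟨s₀, hs₀σ, hs₀v⟩ := exists_skew_valued_eq_exp_neg_one L v w hw he h2w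
  have hs₀U : IsUnit s₀ := K2E3DepthZeroIwahoriCharacterCM.isUnit_of_apply_ne_zero L v w hw s₀ (fun h => by rw [h, map_zero] at hs₀v; exact WithZero.zero_ne_coe hs₀v)
  have hδ : conjLocal L (IsCMField.complexConj L) v (hs₀U.unit : LocalRing L v) = -(hs₀U.unit : LocalRing L v) := by rw [IsUnit.unit_spec]; exact hs₀σ
  have hδv : Valued.v ((hs₀U.unit : LocalRing L v) w) = WithZero.exp (-1 : ℤ) := by rw [IsUnit.unit_spec]; exact hs₀v
  obtain ⟨a₀, ha₀σ, ha₀v, hχa₀⟩ := hFε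
  have ha₀σ' : conjLocal L (IsCMField.complexConj L) v (a₀ : LocalRing L v) = a₀ := by
    have h := congrArg (fun u : (LocalRing L v)ˣ => (u : LocalRing L v)) ha₀σ
    simpa only [Units.coe_map, MonoidHom.coe_coe] using h
  haveI := isAddHaarMeasure_map_mulSkewUnit_symm L v μY hs₀U.unit hδ
  haveI := regular_map_mulSkewUnit_symm L v μY hs₀U.unit hδ
  rw [setIntegral_sphere_diteInv_sub_eq L v w hw μY χ₁ hs₀U.unit hδ hδv a]
  -- the principal factor is `1` on `C`
  have hϖ1 : Valued.v ϖ ≤ 1 := by rw [hϖ, ← WithZero.exp_zero, WithZero.exp_le_exp]; norm_num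
  have hr : Valued.v ϖ ^ (m + 1) < 1 := by
    rw [pow_succ]
    exact lt_of_le_of_lt (mul_le_of_le_one_left' (pow_le_one' hϖ1 m)) (by rw [hϖ, ← WithZero.exp_zero, WithZero.exp_lt_exp]; norm_num)
  have htriv : ∀ u' : (LocalRing L v)ˣ, Valued.v (((u' : LocalRing L v) - 1) w) ≤ Valued.v ϖ ^ (m + 1) → χ₁ u' = 1 :=
    fun u' hu' => hcond u' (forall_placesOver_of_apply L v w hw hu')
  have hinv : Valued.v ((((hs₀U.unit⁻¹ : (LocalRing L v)ˣ)) : LocalRing L v) w) = (Valued.v ϖ)⁻¹ := by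
    have h := congrArg Valued.v (units_apply_mul_inv_apply L v hs₀U.unit w)
    rw [map_mul, map_one, hδv, ← hϖ] at h
    exact eq_inv_of_mul_eq_one_right h
  have hϖ0 : Valued.v ϖ ≠ 0 := by rw [hϖ]; exact WithZero.exp_ne_zero
  have hpt : ∀ c ∈ {c : ↥(HeisRing.fixedPart (conjLocal L (IsCMField.complexConj L) v)) | Valued.v ((c : LocalRing L v) w) = 1},
      (fun r : LocalRing L v => if h : IsUnit r then (((χ₁ h.unit)⁻¹ : ℂˣ) : ℂ) else 0) (c : LocalRing L v) *
          (fun r : LocalRing L v => if h : IsUnit r then (((χ₁ h.unit)⁻¹ : ℂˣ) : ℂ) else 0)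
            (1 + -(a * ((hs₀U.unit⁻¹ : (LocalRing L v)ˣ) : LocalRing L v)) * ((c : LocalRing L v))⁻¹) =
        (fun r : LocalRing L v => if h : IsUnit r then (((χ₁ h.unit)⁻¹ : ℂˣ) : ℂ) else 0) (c : LocalRing L v) := by
    intro c hc
    rw [Set.mem_setOf_eq] at hc
    have hle : Valued.v ((-(a * ((hs₀U.unit⁻¹ : (LocalRing L v)ˣ) : LocalRing L v)) * ((c : LocalRing L v))⁻¹) w) ≤ Valued.v ϖ ^ (m + 1) := by
      rw [Pi.mul_apply, map_mul, valued_inv_apply_of_valued_eq_one L v w hc, mul_one, Pi.neg_apply, Valuation.map_neg, Pi.mul_apply, map_mul, hinv]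
      calc Valued.v (a w) * (Valued.v ϖ)⁻¹ ≤ Valued.v ϖ ^ (m + 2) * (Valued.v ϖ)⁻¹ := mul_le_mul' hav le_rfl
        _ = Valued.v ϖ ^ (m + 1) := by rw [pow_succ, mul_assoc, mul_inv_cancel₀ hϖ0, mul_one]
    rw [diteInv_one_add_eq_one_of_le L v w hw χ₁ hr htriv hle, mul_one]
  rw [setIntegral_congr_fun (measurableSet_fixedUnits L v w).1 hpt,
    setIntegral_fixedUnits_diteInv_eq_zero_of_unit L v w hw _ χ₁ a₀ ha₀σ' (ha₀v w) hχa₀, mul_zero]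

end Sphere

end Summit.HodgeConjecture.HodgeConjecture.R90.S1.BposRamGaussSphere

end
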